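import Mathlib
import HarnessLib

/-!
# ValiantsHypothesis / LacunarySymmetroid — crux `MatrixDescartes` (stmt-ValiantsHypothesis-18050, V1),
# line `Cruxes/MatrixDescartes/Lines/lorentzian_shadow.lean`, stub `stub_detCurve` (`DetCurve`)

The line `lorentzian-shadow` (tropical / Newton-polytope lens at coefficient level) restricts the polynomial
`h(s) = det Σ_l s_l A_l` to a SIGNED MONOMIAL CURVE `s_l = σ_l x^{e_l}`. Its bookkeeping stub `stub_detCurve :
DetCurve` (size S/M, "algebra") says that the determinant of the signed split pencil `Σ_l x^{e_l} σ_l A_l` IS that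
restriction:

  `det (Σ_l X^{e_l} • (σ_l A_l)) = Σ_{α ∈ Δ(m,K)} σ^α · [s^α] det(Σ_l s_l A_l) · X^{⟨e,α⟩}`,

`Δ(m,K) = {α : Fin K → ℕ | Σ α = m}` the degree-`m` layer (homogeneity of `det` of degree `m`). This file proves it,
with the line's local vocabulary (`pencil`, `signed`, `layer`, `wt`, `sgnMon`, `curvePoly`, `detArray`) UNFOLDED
to Mathlib terms (the line file lives under `Cruxes/` and carries the other stubs' `sorry`s, so it cannot be
imported here; the two statements agree definitionally, so the line closes its stub by `exact stub_detCurve` —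
the precedent is `…MatrixDescartesStubSplit.lean`).

Proof: with `H = det M`, `M = Σ_l s_l • A_l` over `ℝ[s_1, …, s_K]`, and the evaluation `φ : s_l ↦ σ_l X^{e_l}`
(an `ℝ`-algebra map to `ℝ[X]`): (i) `φ H = det (φ M) = det (pencil)` (`RingHom.map_det`, entrywise); (ii)
`φ H = Σ_{d ∈ supp H} [s^d]H · σ^d · X^{⟨e,d⟩}` (`MvPolynomial.as_sum`, `aeval_monomial`); (iii) `H` is
homogeneous of degree `m` (Leibniz expansion `Matrix.det_apply'`, every entry of `M` homogeneous of degree `1`),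
so `supp H ⊆ Δ(m,K)` and the two sums agree after reindexing functions and finitely supported functions.

Honest framing: a bookkeeping identity on a registered ALTERNATIVE line of the V1 crux; the line's law
`stub_lorentzianDescartes`, `stub_detLorentzian` (Borcea–Brändén / Brändén–Huh), the sign-split rule `stub_bmd`,
`MatrixDescartes`, Conjecture B and `VP ≠ VNP` are all OPEN / NOT proved, and nothing here is progress on them.
No definitions, no named facts.
-/

-- `Summit.ValiantsHypothesis.ValiantsHypothesis.…` is the tree's mandated single-conjunct layout (Sub = Summit).
set_option linter.dupNamespace false

noncomputable section

namespace Summit.ValiantsHypothesis.ValiantsHypothesis.Theorems.LacunarySymmetroidMatrixDescartes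

open Polynomial Matrix Finset
open scoped BigOperators

namespace DetCurve

variable {K m : ℕ}

/-! ### The generic pencil `M = Σ_l s_l • A_l` and its determinant -/

/-- Entries of the generic pencil `Σ_l s_l • A_l`. [folklore] -/
theorem genericPencil_apply (A : Fin K → Matrix (Fin m) (Fin m) ℝ) (i j : Fin m) :
    (∑ l, (MvPolynomial.X l : MvPolynomial (Fin K) ℝ) • (A l).map (MvPolynomial.C : ℝ →+* MvPolynomial (Fin K) ℝ)) i j =
      ∑ l, MvPolynomial.X l * MvPolynomial.C ((A l) i j) := by
  simp [Matrix.sum_apply, Matrix.smul_apply, Matrix.map_apply, smul_eq_mul]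

/-- The determinant of the generic pencil is homogeneous of degree `m` (Leibniz expansion; every entry is
homogeneous of degree `1`). [folklore] -/
theorem det_genericPencil_isHomogeneous (A : Fin K → Matrix (Fin m) (Fin m) ℝ) :
    (∑ l, (MvPolynomial.X l : MvPolynomial (Fin K) ℝ) • (A l).map (MvPolynomial.C : ℝ →+* MvPolynomial (Fin K) ℝ)).det.IsHomogeneous m := by
  classical
  have key : (∑ l, (MvPolynomial.X l : MvPolynomial (Fin K) ℝ) •
      (A l).map (MvPolynomial.C : ℝ →+* MvPolynomial (Fin K) ℝ)).det.IsHomogeneous (0 + ∑ _i : Fin m, 1) := by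
    rw [Matrix.det_apply']
    refine MvPolynomial.IsHomogeneous.sum _ _ _ fun τ _ => ?_
    refine MvPolynomial.IsHomogeneous.mul ?_ ?_
    · -- the sign is a constant
      have : ((Equiv.Perm.sign τ : ℤ) : MvPolynomial (Fin K) ℝ) =
          MvPolynomial.C (((Equiv.Perm.sign τ : ℤ) : ℝ)) := by
        rw [← map_intCast (MvPolynomial.C : ℝ →+* MvPolynomial (Fin K) ℝ)]
      rw [this]
      exact MvPolynomial.isHomogeneous_C _ _
    · refine MvPolynomial.IsHomogeneous.prod _ _ _ fun i _ => ?_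
      rw [genericPencil_apply]
      refine MvPolynomial.IsHomogeneous.sum _ _ _ fun l _ => ?_
      have h1 : (1 : ℕ) = 1 + 0 := rfl
      rw [h1]
      exact (MvPolynomial.isHomogeneous_X ℝ l).mul (MvPolynomial.isHomogeneous_C _ _)
  intro d hd
  rw [key hd]
  simp

/-- Support of the determinant of the generic pencil: every exponent has total `Σ_i d_i = m`. [folklore] -/
theorem sum_eq_of_mem_support_det (A : Fin K → Matrix (Fin m) (Fin m) ℝ) {d : Fin K →₀ ℕ}
    (hd : d ∈ (∑ l, (MvPolynomial.X l : MvPolynomial (Fin K) ℝ) • (A l).map (MvPolynomial.C : ℝ →+* MvPolynomial (Fin K) ℝ)).det.support) :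
    ∑ i, d i = m := by
  have h := det_genericPencil_isHomogeneous A (MvPolynomial.mem_support_iff.1 hd)
  rw [Finsupp.weight_apply, Finsupp.sum_fintype _ _ (fun i => by simp)] at h
  simpa using h

/-! ### Evaluation on the signed monomial curve -/

/-- The curve evaluation `s_l ↦ σ_l X^{e_l}` maps the generic pencil onto the signed split pencil, entrywise.
[folklore] -/
theorem mapMatrix_genericPencil (A : Fin K → Matrix (Fin m) (Fin m) ℝ) (σ : Fin K → Bool) (e : Fin K → ℕ) :
    ((MvPolynomial.aeval fun l => Polynomial.C (if σ l then (1 : ℝ) else -1) * (X : ℝ[X]) ^ e l :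
        MvPolynomial (Fin K) ℝ →ₐ[ℝ] ℝ[X]) : MvPolynomial (Fin K) ℝ →+* ℝ[X]).mapMatrix
        (∑ l, (MvPolynomial.X l : MvPolynomial (Fin K) ℝ) • (A l).map (MvPolynomial.C : ℝ →+* MvPolynomial (Fin K) ℝ)) =
      ∑ l, (X : ℝ[X]) ^ e l • (((if σ l then (1 : ℝ) else -1) • A l).map C) := by
  set φ : MvPolynomial (Fin K) ℝ →ₐ[ℝ] ℝ[X] :=
    MvPolynomial.aeval fun l => Polynomial.C (if σ l then (1 : ℝ) else -1) * (X : ℝ[X]) ^ e l with hφ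
  refine Matrix.ext fun i j => ?_
  have lhs : ((φ : MvPolynomial (Fin K) ℝ →+* ℝ[X]).mapMatrix
      (∑ l, (MvPolynomial.X l : MvPolynomial (Fin K) ℝ) •
        (A l).map (MvPolynomial.C : ℝ →+* MvPolynomial (Fin K) ℝ))) i j =
      ∑ l, φ (MvPolynomial.X l * MvPolynomial.C ((A l) i j)) := by
    rw [RingHom.mapMatrix_apply, Matrix.map_apply, genericPencil_apply, RingHom.coe_coe, map_sum]
  have rhs : (∑ l, (X : ℝ[X]) ^ e l • (((if σ l then (1 : ℝ) else -1) • A l).map C)) i j =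
      ∑ l, (X : ℝ[X]) ^ e l * C ((if σ l then (1 : ℝ) else -1) * (A l) i j) := by
    rw [Matrix.sum_apply]
    refine Finset.sum_congr rfl fun l _ => ?_
    rw [Matrix.smul_apply, Matrix.map_apply, Matrix.smul_apply, smul_eq_mul, smul_eq_mul]
  rw [lhs, rhs]
  refine Finset.sum_congr rfl fun l _ => ?_
  rw [map_mul, hφ, MvPolynomial.aeval_X, MvPolynomial.aeval_C, Polynomial.algebraMap_eq, map_mul]
  ring

/-- The curve evaluation of a monomial `c · s^d`: `c · σ^d · X^{⟨e,d⟩}`. [folklore] -/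
theorem aeval_curve_monomial (σ : Fin K → Bool) (e : Fin K → ℕ) (d : Fin K →₀ ℕ) (c : ℝ) :
    (MvPolynomial.aeval fun l => Polynomial.C (if σ l then (1 : ℝ) else -1) * (X : ℝ[X]) ^ e l)
        (MvPolynomial.monomial d c) =
      Polynomial.C (c * ∏ i, (if σ i then (1 : ℝ) else -1) ^ d i) * (X : ℝ[X]) ^ (∑ i, e i * d i) := by
  rw [MvPolynomial.aeval_monomial, Polynomial.algebraMap_eq, Finsupp.prod_fintype _ _ (fun i => by simp)]
  simp only [mul_pow, ← pow_mul, Finset.prod_mul_distrib, Finset.prod_pow_eq_pow_sum, ← map_pow, ← map_prod,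
    map_mul]
  ring

/-! ### The stub -/

/-- **`stub_detCurve` (`DetCurve`) of line `lorentzian_shadow`, verbatim with the line's vocabulary unfolded:**
for real `m × m` matrices `A_l` (`l < K`), signs `σ_l` and exponents `e_l`,
`det (Σ_l X^{e_l} • (σ_l A_l)) = Σ_{α ∈ Δ(m,K)} C(σ^α · [s^α] det (Σ_l s_l A_l)) · X^{Σ_i e_i α_i}` — the determinant
of the signed split pencil is the restriction of the coefficient array of `det Σ_l s_l A_l` to the signed
monomial curve `s_l = σ_l X^{e_l}` (degree-`m` homogeneity of `det`). V1 line stub; `MatrixDescartes`,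
Conjecture B, `VP ≠ VNP` OPEN. [folklore] -/
theorem stub_detCurve :
    ∀ (m K : ℕ) (A : Fin K → Matrix (Fin m) (Fin m) ℝ) (σ : Fin K → Bool) (e : Fin K → ℕ),
      (∑ l, (X : ℝ[X]) ^ e l • (((if σ l then (1 : ℝ) else -1) • A l).map C)).det =
        ∑ α ∈ (Fintype.piFinset fun _ : Fin K => Finset.range (m + 1)).filter (fun α => ∑ i, α i = m),
          C ((∏ i, (if σ i then (1 : ℝ) else -1) ^ α i) *
              MvPolynomial.coeff (Finsupp.equivFunOnFinite.symm α)
                (Matrix.det (∑ l, (MvPolynomial.X l : MvPolynomial (Fin K) ℝ) • (A l).map (MvPolynomial.C : ℝ →+* MvPolynomial (Fin K) ℝ)))) *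
            X ^ (∑ i, e i * α i) := by
  classical
  intro m K A σ e
  set M : Matrix (Fin m) (Fin m) (MvPolynomial (Fin K) ℝ) :=
    ∑ l, (MvPolynomial.X l : MvPolynomial (Fin K) ℝ) • (A l).map (MvPolynomial.C : ℝ →+* MvPolynomial (Fin K) ℝ) with hM
  set H : MvPolynomial (Fin K) ℝ := M.det with hH
  set φ : MvPolynomial (Fin K) ℝ →ₐ[ℝ] ℝ[X] :=
    MvPolynomial.aeval fun l => Polynomial.C (if σ l then (1 : ℝ) else -1) * (X : ℝ[X]) ^ e l with hφ
  set L := (Fintype.piFinset fun _ : Fin K => Finset.range (m + 1)).filter (fun α => ∑ i, α i = m) with hL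
  -- the summand, as a function of a finitely supported exponent
  set F : (Fin K →₀ ℕ) → ℝ[X] := fun d =>
    Polynomial.C (MvPolynomial.coeff d H * ∏ i, (if σ i then (1 : ℝ) else -1) ^ d i) *
      (X : ℝ[X]) ^ (∑ i, e i * d i) with hF
  -- (i) the left-hand side is `φ H`
  have hlhs : (∑ l, (X : ℝ[X]) ^ e l • (((if σ l then (1 : ℝ) else -1) • A l).map C)).det = φ H := by
    rw [hH, show (φ : MvPolynomial (Fin K) ℝ →ₐ[ℝ] ℝ[X]) M.det = (φ : MvPolynomial (Fin K) ℝ →+* ℝ[X]) M.det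
      from rfl, RingHom.map_det, hφ, hM, mapMatrix_genericPencil]
  -- (ii) `φ H` as a sum over the support of `H`
  have hφH : φ H = ∑ d ∈ H.support, F d := by
    conv_lhs => rw [H.as_sum]
    rw [map_sum]
    refine Finset.sum_congr rfl fun d _ => ?_
    rw [hφ, aeval_curve_monomial]
  -- (iii) the right-hand side as a sum over `L.image equivFunOnFinite.symm ⊇ supp H`
  have hrhs : ∑ α ∈ L, C ((∏ i, (if σ i then (1 : ℝ) else -1) ^ α i) *
        MvPolynomial.coeff (Finsupp.equivFunOnFinite.symm α) H) * X ^ (∑ i, e i * α i) =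
      ∑ d ∈ L.image (fun α => (Finsupp.equivFunOnFinite.symm α : Fin K →₀ ℕ)), F d := by
    rw [Finset.sum_image fun α _ β _ h => Finsupp.equivFunOnFinite.symm.injective h]
    refine Finset.sum_congr rfl fun α _ => ?_
    simp only [hF, Finsupp.coe_equivFunOnFinite_symm, mul_comm]
  have hsub : H.support ⊆ L.image fun α => (Finsupp.equivFunOnFinite.symm α : Fin K →₀ ℕ) := by
    intro d hd
    have hsum : ∑ i, d i = m := sum_eq_of_mem_support_det A hd
    refine Finset.mem_image.2 ⟨⇑d, ?_, by ext i; simp⟩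
    rw [hL, Finset.mem_filter, Fintype.mem_piFinset]
    refine ⟨fun i => Finset.mem_range.2 (Nat.lt_succ_of_le ?_), hsum⟩
    rw [← hsum]
    exact Finset.single_le_sum (f := fun i => d i) (fun _ _ => Nat.zero_le _) (Finset.mem_univ i)
  have hzero : ∀ d ∈ L.image (fun α => (Finsupp.equivFunOnFinite.symm α : Fin K →₀ ℕ)), d ∉ H.support →
      F d = 0 := by
    intro d _ hd
    rw [MvPolynomial.notMem_support_iff] at hd
    simp [hF, hd]
  rw [hlhs, hφH, hrhs]
  exact (Finset.sum_subset hsub hzero).symm ▸ rfl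

end DetCurve

end Summit.ValiantsHypothesis.ValiantsHypothesis.Theorems.LacunarySymmetroidMatrixDescartes

end
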